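import Mathlib
import Literature.NumberTheory.DiophantineGeometry.BelyiPolynomialHeight

/-!
# Proof of Rodriguez's prime floor for Belyi polynomials (`Rodriguez2013_prime_le_natDegree`)

This file discharges the named fact
`Literature.NumberTheory.DiophantineGeometry.Rodriguez2013_prime_le_natDegree` of
`BelyiPolynomialHeight.lean` — J. Rodriguez, *Bounding the degree of Belyi polynomials*,
J. Number Theory 133 (2013), Thm. 3 in its printed rational form: a Belyi polynomial `B ∈ ℚ̄[x]`
(`B(0), B(1) ∈ {0,1}`, critical values in `{0,1}`) with `B(a/b) ∈ {0,1}`, `a/b ≠ 0` in lowest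
terms, has `deg B ≥ p` for every prime `p ∣ ab` — by the theorem
`Rodriguez2013_prime_le_natDegree_holds`.  No statement is changed; this file only adds proofs.

## The argument (Rodriguez 2013, §3, read on the held arXiv text 1104.2027, pp. 5–8)

Suppose `n = deg B < p`.  Work in the number field `K = ℚ(coefficients of B, roots of B, roots
of B - 1) ⊂ ℂ` with the valuation `v` of a prime `𝔭 ∣ p` of `𝓞 K` (so `v(m) = 1` for
`1 ≤ m ≤ n < p`: this is the source's Lemma 3 (3), "`ν_p(aᵢ) = ν_p(i · aᵢ)`", i.e.
`New_p(B) = New_p(x B')` for `deg B < p`).  The heart is `valuation_eq_one_of_critical_values`: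
*every non-zero `z` with `B(z) ∈ {0,1}` is a `v`-unit*, which is the content of Thms. 1–2 ("all
non-zero roots of `B(x)` and `B(x) - 1` have the same valuation", proof of Thm. 3, p. 8) once one
remembers that `1` is such a root.  We follow the source's route in a streamlined form:

* (Lemma 7) rescale by a non-zero root `γ` of `B (B - 1)` of least valuation:
  `R(x) = B(γx)/(cγⁿ)` and `R - δ = (B(γx) - 1)/(cγⁿ)`, `δ = 1/(cγⁿ)`, are monic with roots in the
  valuation ring `𝒪`, hence lie in `𝒪[x]`, and so does `R' = n · ∏ (x - ·)`;
* (Thm. 2, "using the reduction map `π`") reduce to the residue field `κ`: `F = π(R)`,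
  `G = π(R - δ) = F - π(δ)`, `F' = n̄ · π(∏ …)` with `n̄ ≠ 0`;
* (Lemma 5 / Cor. 6 and Thm. 1, here as one *root count*, `card_roots_add_card_roots_eq` /
  `card_roots_eq_one`): over a domain in which `1, …, n` are non-zero, if `F`, `G = F - δ`, `F'`
  split and every root of `F'` is a root of `F` or `G`, then `#Z(F) + #Z(G) = n + 1` when `δ ≠ 0`
  (tame Riemann–Hurwitz), while `#Z(F) = 1` when `δ = 0` (Cor. 6: `F' ∣ F²` forces one root).
  In `κ` the case `π(δ) = 0` is impossible (`0̄` and `1̄ = π(γ/γ)` are distinct roots), and in the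
  case `π(δ) ≠ 0` comparing the count in `κ` with the same count in `K` shows that reduction is
  injective on the roots, so no non-zero root of `R (R - δ)` reduces to `0`: all non-zero roots of
  `B (B - 1)` have valuation `v(γ)`, and `γ ↦ 1` gives `v(γ) = 1`.

Finally `v(a/b) ≠ 1` when `p ∣ ab`, `gcd(a,b) = 1` — contradiction (Thm. 3 and the remark after
it).  The descent `ℂ → K` uses that roots of a polynomial with algebraic coefficients are
algebraic (via `algebraicClosure ℚ ℂ`) and `Polynomial.Splits.of_splits_map`.

## References

* [Rodriguez2013] J. Rodriguez, Bounding the degree of Belyi polynomials, J. Number Theory 133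
  (2013) 2892–2900, arXiv:1104.2027: Lemma 3, Lemma 5, Cor. 6, Lemma 7, Thms. 1, 2, 3.
-/

namespace Literature.NumberTheory.DiophantineGeometry

open Polynomial

section Count

variable {L : Type*} [CommRing L] [IsDomain L]

/-- For a split polynomial whose roots lie in the finite set `T`, the degree is the sum over `T`
of the root multiplicities. [folklore] -/
theorem sum_rootMultiplicity_eq_natDegree_of_splits [DecidableEq L] {P : L[X]} (hP : P.Splits)
    {T : Finset L} (hT : P.roots.toFinset ⊆ T) :
    ∑ t ∈ T, P.rootMultiplicity t = P.natDegree := by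
  rw [hP.natDegree_eq_card_roots, ← Multiset.toFinset_sum_count_eq P.roots,
    ← Finset.sum_subset hT]
  · exact Finset.sum_congr rfl fun t _ => (count_roots P).symm
  · intro t _ ht
    rw [← count_roots]
    exact Multiset.count_eq_zero.mpr fun h => ht (Multiset.mem_toFinset.mpr h)

/-- If the multiplicity `m` of a root `t` of `F` is non-zero in the domain `L`, the derivative
`F'` has multiplicity exactly `m - 1` at `t`; here under the hypothesis that every positive
integer up to `deg F` is non-zero in `L`. [folklore] -/
theorem rootMultiplicity_derivative_of_cast_ne_zero {F : L[X]} (hF : F ≠ 0)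
    (hchar : ∀ m : ℕ, 0 < m → m ≤ F.natDegree → (m : L) ≠ 0) {t : L} (ht : F.IsRoot t) :
    F.derivative.rootMultiplicity t = F.rootMultiplicity t - 1 := by
  classical
  apply derivative_rootMultiplicity_of_root_of_mem_nonZeroDivisors ht
  apply mem_nonZeroDivisors_of_ne_zero
  apply hchar
  · exact (rootMultiplicity_pos hF).mpr ht
  · rw [← count_roots]
    exact (Multiset.count_le_card _ _).trans (card_roots' F)

/-- Summing `mult_t(F') = mult_t(F) - 1` over the distinct roots of a split `F`:
`Σ_{t ∈ Z(F)} mult_t(F') + #Z(F) = deg F`. [folklore] -/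
theorem sum_rootMultiplicity_derivative_add_card [DecidableEq L] {F : L[X]} (hF : F ≠ 0)
    (hs : F.Splits) (hchar : ∀ m : ℕ, 0 < m → m ≤ F.natDegree → (m : L) ≠ 0) :
    ∑ t ∈ F.roots.toFinset, F.derivative.rootMultiplicity t + F.roots.toFinset.card =
      F.natDegree := by
  rw [Finset.card_eq_sum_ones, ← Finset.sum_add_distrib,
    ← sum_rootMultiplicity_eq_natDegree_of_splits hs subset_rfl]
  refine Finset.sum_congr rfl fun t ht => ?_
  have hroot : F.IsRoot t := (mem_roots hF).1 (Multiset.mem_toFinset.1 ht)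
  rw [rootMultiplicity_derivative_of_cast_ne_zero hF hchar hroot]
  have := (rootMultiplicity_pos hF).mpr hroot
  omega

/-- Over a domain in which `n = deg F ≥ 1` is non-zero, the coefficient of `x^{n-1}` in `F'` is
non-zero. [folklore] -/
theorem coeff_derivative_ne_zero_of_cast_ne_zero {F : L[X]} (hn : 0 < F.natDegree)
    (hchar : (F.natDegree : L) ≠ 0) : F.derivative.coeff (F.natDegree - 1) ≠ 0 := by
  obtain ⟨k, hk⟩ : ∃ k, F.natDegree = k + 1 := ⟨F.natDegree - 1, by omega⟩
  rw [coeff_derivative, hk, Nat.add_sub_cancel]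
  refine mul_ne_zero ?_ ?_
  · rw [← hk]
    exact coeff_ne_zero_of_eq_degree (degree_eq_natDegree (ne_zero_of_natDegree_gt hn))
  · rw [hk] at hchar
    exact_mod_cast hchar

/-- The derivative of a polynomial of degree `n ≥ 1` over a domain in which `n ≠ 0` is non-zero.
[folklore] -/
theorem derivative_ne_zero_of_cast_ne_zero {F : L[X]} (hn : 0 < F.natDegree)
    (hchar : (F.natDegree : L) ≠ 0) : F.derivative ≠ 0 := fun h =>
  coeff_derivative_ne_zero_of_cast_ne_zero hn hchar (by rw [h, coeff_zero])

/-- The derivative of a polynomial of degree `n ≥ 1` over a domain in which `n ≠ 0` has degree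
exactly `n - 1`. [folklore] -/
theorem natDegree_derivative_of_cast_ne_zero {F : L[X]} (hn : 0 < F.natDegree)
    (hchar : (F.natDegree : L) ≠ 0) : F.derivative.natDegree = F.natDegree - 1 :=
  le_antisymm (natDegree_derivative_le F)
    (le_natDegree_of_ne_zero (coeff_derivative_ne_zero_of_cast_ne_zero hn hchar))

/-- **Tame Riemann–Hurwitz count for a pair `F`, `G = F - δ`, `δ ≠ 0`.**  Over a domain `L` in
which `1, …, deg F` are non-zero, let `F`, `G`, `F'` split, `F - G = δ ≠ 0` a constant, and suppose
every root of `F' (= G')` is a root of `F` or of `G`.  Then `#Z(F) + #Z(G) = deg F + 1`.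
(The count behind Rodriguez 2013, Lemma 5 / Cor. 6 and Thms. 1–2.)
[cite: Rodriguez2013, Lemma 5 and Cor. 6] -/
theorem card_roots_add_card_roots_eq [DecidableEq L] {F G : L[X]} {δ : L} (hδ : δ ≠ 0)
    (hFG : F - G = C δ) (hn : 0 < F.natDegree) (hsF : F.Splits) (hsG : G.Splits)
    (hsF' : F.derivative.Splits)
    (hchar : ∀ m : ℕ, 0 < m → m ≤ F.natDegree → (m : L) ≠ 0)
    (hcrit : ∀ t, F.derivative.IsRoot t → F.IsRoot t ∨ G.IsRoot t) :
    F.roots.toFinset.card + G.roots.toFinset.card = F.natDegree + 1 := by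
  have hF : F ≠ 0 := ne_zero_of_natDegree_gt hn
  have hGF : G = F - C δ := by rw [← hFG]; ring
  have hdeg : G.natDegree = F.natDegree := by
    rw [hGF, natDegree_sub_C]
  have hG : G ≠ 0 := by
    intro h; rw [h, natDegree_zero] at hdeg; omega
  have hder : G.derivative = F.derivative := by
    rw [hGF, derivative_sub, derivative_C, sub_zero]
  -- the root sets are disjoint
  have hdisj : Disjoint F.roots.toFinset G.roots.toFinset := by
    rw [Finset.disjoint_left]
    intro t htF htG
    rw [Multiset.mem_toFinset, mem_roots hF] at htF
    rw [Multiset.mem_toFinset, mem_roots hG] at htG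
    apply hδ
    have h := congrArg (eval t) hFG
    rw [eval_sub, htF.eq_zero, htG.eq_zero, eval_C, sub_zero] at h
    exact h.symm
  -- degree of F'
  have hdF' : F.derivative.natDegree = F.natDegree - 1 :=
    natDegree_derivative_of_cast_ne_zero hn (hchar _ hn le_rfl)
  have hF' : F.derivative ≠ 0 := derivative_ne_zero_of_cast_ne_zero hn (hchar _ hn le_rfl)
  -- roots of F' lie in Z(F) ∪ Z(G)
  have hsub : F.derivative.roots.toFinset ⊆ F.roots.toFinset ∪ G.roots.toFinset := by
    intro t ht
    rw [Multiset.mem_toFinset, mem_roots hF'] at ht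
    rcases hcrit t ht with h | h
    · exact Finset.mem_union_left _ (Multiset.mem_toFinset.mpr ((mem_roots hF).mpr h))
    · exact Finset.mem_union_right _ (Multiset.mem_toFinset.mpr ((mem_roots hG).mpr h))
  have hsum := sum_rootMultiplicity_eq_natDegree_of_splits hsF' hsub
  rw [Finset.sum_union hdisj, hdF'] at hsum
  have h1 := sum_rootMultiplicity_derivative_add_card hF hsF hchar
  have h2 := sum_rootMultiplicity_derivative_add_card hG hsG (hdeg ▸ hchar)
  rw [hder, hdeg] at h2
  omega

/-- **The degenerate count (`δ = 0`).**  Over a domain `L` in which `1, …, deg F` are non-zero, if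
`F` and `F'` split and every root of `F'` is a root of `F` (i.e. `F' ∣ F^N`), then `F` has exactly
one distinct root (`F = a (x - t)^n`; Rodriguez 2013, Lemma 5 / Cor. 6: with `F(0) = 0`,
`F = a x^n`). [cite: Rodriguez2013, Lemma 5 and Cor. 6] -/
theorem card_roots_eq_one [DecidableEq L] {F : L[X]} (hn : 0 < F.natDegree) (hsF : F.Splits)
    (hsF' : F.derivative.Splits)
    (hchar : ∀ m : ℕ, 0 < m → m ≤ F.natDegree → (m : L) ≠ 0)
    (hcrit : ∀ t, F.derivative.IsRoot t → F.IsRoot t) :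
    F.roots.toFinset.card = 1 := by
  have hF : F ≠ 0 := ne_zero_of_natDegree_gt hn
  have hdF' : F.derivative.natDegree = F.natDegree - 1 :=
    natDegree_derivative_of_cast_ne_zero hn (hchar _ hn le_rfl)
  have hF' : F.derivative ≠ 0 := derivative_ne_zero_of_cast_ne_zero hn (hchar _ hn le_rfl)
  have hsub : F.derivative.roots.toFinset ⊆ F.roots.toFinset := by
    intro t ht
    rw [Multiset.mem_toFinset, mem_roots hF'] at ht
    exact Multiset.mem_toFinset.mpr ((mem_roots hF).mpr (hcrit t ht))
  have hsum := sum_rootMultiplicity_eq_natDegree_of_splits hsF' hsub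
  rw [hdF'] at hsum
  have h1 := sum_rootMultiplicity_derivative_add_card hF hsF hchar
  omega

end Count

section LinProd

variable {R S : Type*} [CommRing R] [CommRing S]

/-- `∏_{a ∈ M} (x - a)` maps under a ring homomorphism `f` to `∏_{a ∈ M} (x - f a)`. [folklore] -/
theorem map_multiset_prod_X_sub_C (M : Multiset R) (f : R →+* S) :
    ((M.map fun a => X - C a).prod).map f = ((M.map f).map fun a => X - C a).prod := by
  rw [Polynomial.map_multiset_prod, Multiset.map_map, Multiset.map_map]
  congr 1
  exact Multiset.map_congr rfl fun a _ => by simp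

/-- A product of monic linear factors splits (by definition). [folklore] -/
theorem splits_multiset_prod_X_sub_C (M : Multiset R) :
    ((M.map fun a => X - C a).prod).Splits :=
  Splits.multisetProd fun f hf => by
    obtain ⟨a, _, rfl⟩ := Multiset.mem_map.mp hf
    exact Splits.X_sub_C a

/-- A multiset all of whose elements lie in a subset lifts to a multiset of the subtype. This is
Mathlib's `CanLift.prf` for the instances `Multiset.canLift`/`Subtype.canLift` (tactic form: `lift M
to Multiset {x // p x} using h`); the name is kept for the three uses below. [folklore] -/
theorem exists_multiset_map_val_eq {K : Type*} {p : K → Prop} (M : Multiset K)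
    (h : ∀ a ∈ M, p a) : ∃ N : Multiset {x // p x}, N.map Subtype.val = M :=
  CanLift.prf M h

end LinProd

section Core

variable {K : Type*} [Field K] {Γ₀ : Type*} [LinearOrderedCommGroupWithZero Γ₀]

/-- In the valuation ring `𝒪_v = {v ≤ 1}` of a valuation `v`, the units are exactly the elements of
valuation `1`. [folklore] -/
theorem isUnit_valuationSubring_iff (v : Valuation K Γ₀) (a : v.valuationSubring) :
    IsUnit a ↔ v (a : K) = 1 := by
  rw [ValuationSubring.valuation_eq_one_iff]
  exact ((Valuation.isEquiv_valuation_valuationSubring v).eq_one_iff_eq_one).symm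

/-- If `v (γ a) ≤ v γ` with `γ ≠ 0` then `v a ≤ 1`. [folklore] -/
theorem valuation_le_one_of_mul_le (v : Valuation K Γ₀) {γ a : K} (hγ : γ ≠ 0)
    (h : v (γ * a) ≤ v γ) : v a ≤ 1 := by
  have hvγ : v γ ≠ 0 := (Valuation.ne_zero_iff v).mpr hγ
  have : v a = v (γ * a) / v γ := by
    rw [map_mul, mul_comm, mul_div_assoc, div_self hvγ, mul_one]

  rw [this]
  exact (div_le_one₀ (zero_lt_iff.mpr hvγ)).mpr h

end Core

section Core

variable {K : Type*} [Field K] [CharZero K] {Γ₀ : Type*} [LinearOrderedCommGroupWithZero Γ₀]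

/-- **Rodriguez 2013, Theorems 1–3, in valuation form (the heart of the prime floor).**  Let `v` be
a valuation on a field `K` of characteristic `0` and `B ∈ K[x]` a polynomial of degree `n ≥ 1`
such that `v(m) = 1` for `1 ≤ m ≤ n` (e.g. `n < p` = residue characteristic), `B(0), B(1) ∈ {0,1}`,
every critical point of `B` in `K` has critical value in `{0,1}`, and `B`, `B - 1`, `B'` split in
`K`.  Then every non-zero `z` with `B(z) ∈ {0,1}` is a `v`-unit: "all non-zero roots of `B(x)` and
`B(x) - 1` have the same valuation … `ν_p(1) = ν_p(λ) = 0`" (proof of Thm. 3, p. 8).  Proof as in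
the source, §3: rescale by a root `γ` of least valuation (Lemma 7), pass to the residue field
(`R ∈ 𝒪_p[x]`, reduction `π`, Thm. 2) and count roots of `F`, `F - δ̄`, `F'` there (Lemma 5 /
Cor. 6, Thm. 1 via Lemma 3 (3): `ν_p(i aᵢ) = ν_p(aᵢ)` for `i < p`).
[cite: Rodriguez2013, Thms. 1–3] -/
theorem valuation_eq_one_of_critical_values (v : Valuation K Γ₀) {B : K[X]}
    (hn : 0 < B.natDegree) (hsmall : ∀ m : ℕ, 0 < m → m ≤ B.natDegree → v m = 1)
    (h0 : B.eval 0 = 0 ∨ B.eval 0 = 1) (h1 : B.eval 1 = 0 ∨ B.eval 1 = 1)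
    (hcrit : ∀ z, B.derivative.eval z = 0 → B.eval z = 0 ∨ B.eval z = 1)
    (hsB : B.Splits) (hsB1 : (B - 1).Splits) (hsB' : B.derivative.Splits)
    {z : K} (hz : z ≠ 0) (hBz : B.eval z = 0 ∨ B.eval z = 1) : v z = 1 := by
  classical
  have hB : B ≠ 0 := ne_zero_of_natDegree_gt hn
  have hB1 : B - 1 ≠ 0 := by
    intro h
    have h' : (B - C 1).natDegree = B.natDegree := natDegree_sub_C
    rw [C_1, h, natDegree_zero] at h'
    omega
  /- Step 1 (Lemma 7): a non-zero root `γ` of `B (B - 1)` of largest `v`. -/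
  obtain ⟨γ, hγ0, hγB, hγmax⟩ : ∃ γ : K, γ ≠ 0 ∧ (B.eval γ = 0 ∨ B.eval γ = 1) ∧
      ∀ w : K, w ≠ 0 → (B.eval w = 0 ∨ B.eval w = 1) → v w ≤ v γ := by
    have hmem : ∀ w : K, w ∈ ((B * (B - 1)).roots.toFinset.filter (· ≠ 0)) ↔
        w ≠ 0 ∧ (B.eval w = 0 ∨ B.eval w = 1) := by
      intro w
      rw [Finset.mem_filter, Multiset.mem_toFinset, mem_roots (mul_ne_zero hB hB1), IsRoot.def,
        eval_mul, eval_sub, eval_one, mul_eq_zero, sub_eq_zero]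
      tauto
    obtain ⟨γ, hγZ, hγmax⟩ :=
      Finset.exists_max_image _ v ⟨1, (hmem 1).2 ⟨one_ne_zero, h1⟩⟩
    exact ⟨γ, ((hmem γ).1 hγZ).1, ((hmem γ).1 hγZ).2,
      fun w hw hBw => hγmax w ((hmem w).2 ⟨hw, hBw⟩)⟩
  /- Step 2: rescale, `R(x) = B(γ x) / (c γ^n)` (monic), `R - δ = (B(γx) - 1)/(cγ^n)`. -/
  set n := B.natDegree with hn_def
  have hc : B.leadingCoeff ≠ 0 := leadingCoeff_ne_zero.mpr hB
  set u : K := B.leadingCoeff * γ ^ n with hu_def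
  have hu : u ≠ 0 := mul_ne_zero hc (pow_ne_zero _ hγ0)
  set δ : K := u⁻¹ with hδ_def
  have hδ : δ ≠ 0 := inv_ne_zero hu
  set L : K[X] := C γ * X with hL_def
  have hLdeg : L.natDegree = 1 := natDegree_C_mul_X γ hγ0
  have hLeval : ∀ a, L.eval a = γ * a := fun a => by simp [hL_def]
  set R : K[X] := C δ * B.comp L with hR_def
  have hRn : R.natDegree = n := by
    rw [hR_def, natDegree_C_mul hδ, natDegree_comp, hLdeg, mul_one]
  have hRmonic : R.Monic := by
    rw [Monic, hR_def, leadingCoeff_mul, leadingCoeff_C,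
      leadingCoeff_comp (by rw [hLdeg]; exact one_ne_zero), hL_def, leadingCoeff_C_mul_X]
    exact inv_mul_cancel₀ hu
  have hR0 : R ≠ 0 := hRmonic.ne_zero
  have hReval : ∀ a, R.eval a = δ * B.eval (γ * a) := fun a => by
    simp [hR_def, eval_comp, hLeval]
  have hR1 : R - C δ = C δ * (B - 1).comp L := by
    rw [sub_comp, one_comp, mul_sub, mul_one]
  have hR1eval : ∀ a, (R - C δ).eval a = δ * (B.eval (γ * a) - 1) := fun a => by
    rw [hR1]; simp [eval_comp, hLeval]
  have hR1monic : (R - C δ).Monic := by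
    apply hRmonic.sub_of_left
    calc (C δ).degree ≤ 0 := degree_C_le
      _ < R.degree := by
        rw [degree_eq_natDegree hR0, hRn]; exact_mod_cast hn
  have hR10 : R - C δ ≠ 0 := hR1monic.ne_zero
  have hR' : R.derivative = C (δ * γ) * B.derivative.comp L := by
    rw [hR_def, derivative_C_mul, derivative_comp, hL_def, derivative_C_mul_X, ← mul_assoc,
      ← C_mul]
  have hR'eval : ∀ a, R.derivative.eval a = δ * γ * B.derivative.eval (γ * a) := fun a => by
    rw [hR']; simp [eval_comp, hLeval]
  have hR'0 : R.derivative ≠ 0 := by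
    rw [Ne, derivative_eq_zero, hRn]; exact hn.ne'
  have hsR : R.Splits := (hsB.comp_of_natDegree_le_one hLdeg.le).C_mul δ
  have hsR1 : (R - C δ).Splits := by
    rw [hR1]; exact (hsB1.comp_of_natDegree_le_one hLdeg.le).C_mul δ
  have hsR' : R.derivative.Splits := by
    rw [hR']; exact (hsB'.comp_of_natDegree_le_one hLdeg.le).C_mul _
  have hRroot : ∀ a, a ∈ R.roots ↔ B.eval (γ * a) = 0 := fun a => by
    rw [mem_roots hR0, IsRoot.def, hReval, mul_eq_zero, or_iff_right hδ]
  have hR1root : ∀ a, a ∈ (R - C δ).roots ↔ B.eval (γ * a) = 1 := fun a => by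
    rw [mem_roots hR10, IsRoot.def, hR1eval, mul_eq_zero, or_iff_right hδ, sub_eq_zero]
  have hR'root : ∀ a, a ∈ R.derivative.roots → B.eval (γ * a) = 0 ∨ B.eval (γ * a) = 1 := by
    intro a ha
    rw [mem_roots hR'0, IsRoot.def, hR'eval, mul_eq_zero, or_iff_right (mul_ne_zero hδ hγ0)]
      at ha
    exact hcrit _ ha
  -- by the choice of `γ`, all these roots have valuation `≤ 1`
  have hval : ∀ a, (B.eval (γ * a) = 0 ∨ B.eval (γ * a) = 1) → v a ≤ 1 := by
    intro a ha
    by_cases ha0 : a = 0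
    · rw [ha0, map_zero]; exact zero_le
    · exact valuation_le_one_of_mul_le v hγ0 (hγmax _ (mul_ne_zero hγ0 ha0) ha)
  /- Step 3: Riemann–Hurwitz count over `K`: `#Z(R) + #Z(R - δ) = n + 1`. -/
  have hcritR : ∀ t, R.derivative.IsRoot t → R.IsRoot t ∨ (R - C δ).IsRoot t := by
    intro t ht
    rcases hR'root t ((mem_roots hR'0).mpr ht) with h | h
    · exact Or.inl ((mem_roots hR0).mp ((hRroot t).mpr h))
    · exact Or.inr ((mem_roots hR10).mp ((hR1root t).mpr h))
  have hcountK : R.roots.toFinset.card + (R - C δ).roots.toFinset.card = n + 1 := by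
    have h := card_roots_add_card_roots_eq hδ (sub_sub_cancel R (C δ)) (by rw [hRn]; exact hn)
      hsR hsR1 hsR' (fun m hm _ => by exact_mod_cast hm.ne') hcritR
    rwa [hRn] at h
  /- Step 4: the roots lie in the valuation ring `𝒪`; integral models of `R`, `R - δ`, `R'`. -/
  set O := v.valuationSubring with hO_def
  obtain ⟨NR, hNR⟩ : ∃ N : Multiset O, N.map Subtype.val = R.roots :=
    exists_multiset_map_val_eq R.roots fun a ha =>
      (v.mem_valuationSubring_iff a).mpr (hval a (Or.inl ((hRroot a).mp ha)))
  obtain ⟨NS, hNS⟩ : ∃ N : Multiset O, N.map Subtype.val = (R - C δ).roots :=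
    exists_multiset_map_val_eq _ fun a ha =>
      (v.mem_valuationSubring_iff a).mpr (hval a (Or.inr ((hR1root a).mp ha)))
  obtain ⟨ND, hND⟩ : ∃ N : Multiset O, N.map Subtype.val = R.derivative.roots :=
    exists_multiset_map_val_eq _ fun a ha =>
      (v.mem_valuationSubring_iff a).mpr (hval a (hR'root a ha))
  have hvalinj : Function.Injective (Subtype.val : O → K) := Subtype.val_injective
  have hmemR : ∀ d : O, d ∈ NR ↔ B.eval (γ * d) = 0 := fun d => by
    rw [← Multiset.mem_map_of_injective hvalinj, hNR, hRroot]
  have hmemS : ∀ d : O, d ∈ NS ↔ B.eval (γ * d) = 1 := fun d => by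
    rw [← Multiset.mem_map_of_injective hvalinj, hNS, hR1root]
  have hmemD : ∀ d : O, d ∈ ND → d ∈ NR ∨ d ∈ NS := fun d hd => by
    rw [hmemR, hmemS]
    apply hR'root
    rw [← hND]
    exact Multiset.mem_map_of_mem _ hd
  have h0mem : (0 : O) ∈ NR ∨ (0 : O) ∈ NS := by
    rw [hmemR, hmemS]; simpa using h0
  have h1mem : (1 : O) ∈ NR ∨ (1 : O) ∈ NS := by
    rw [hmemR, hmemS]; simpa using hγB
  set PR : O[X] := (NR.map fun a => X - C a).prod with hPR_def
  set PS : O[X] := (NS.map fun a => X - C a).prod with hPS_def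
  set PD : O[X] := (ND.map fun a => X - C a).prod with hPD_def
  have hinj : Function.Injective (algebraMap O K) := hvalinj
  have hφ : (⇑(algebraMap O K) : O → K) = Subtype.val := rfl
  have hmapR : PR.map (algebraMap O K) = R := by
    rw [hPR_def, map_multiset_prod_X_sub_C, hφ, hNR]
    exact (hsR.eq_prod_roots_of_monic hRmonic).symm
  have hmapS : PS.map (algebraMap O K) = R - C δ := by
    rw [hPS_def, map_multiset_prod_X_sub_C, hφ, hNS]
    exact (hsR1.eq_prod_roots_of_monic hR1monic).symm
  have hmapD : (C (n : O) * PD).map (algebraMap O K) = R.derivative := by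
    rw [Polynomial.map_mul, map_C, map_natCast, hPD_def, map_multiset_prod_X_sub_C, hφ, hND]
    have hlc : R.derivative.leadingCoeff = n := by
      rw [leadingCoeff_derivative, hRmonic.leadingCoeff, one_mul, hRn]
    conv_rhs => rw [hsR'.eq_prod_roots, hlc]
  set δO : O := PR.coeff 0 - PS.coeff 0 with hδO_def
  have hδO : algebraMap O K δO = δ := by
    rw [map_sub]
    have e1 : algebraMap O K (PR.coeff 0) = R.coeff 0 := by rw [← coeff_map, hmapR]
    have e2 : algebraMap O K (PS.coeff 0) = (R - C δ).coeff 0 := by rw [← coeff_map, hmapS]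
    rw [e1, e2, coeff_sub, coeff_C_zero]
    ring
  have hPRS : PR - PS = C δO := by
    apply map_injective (algebraMap O K) hinj
    rw [Polynomial.map_sub, hmapR, hmapS, map_C, hδO, sub_sub_cancel]
  have hPRD : PR.derivative = C (n : O) * PD := by
    apply map_injective (algebraMap O K) hinj
    rw [← derivative_map, hmapR, hmapD]
  /- Step 5 (Thm. 2): reduce modulo the maximal ideal of `𝒪`. -/
  set κ := IsLocalRing.ResidueField O with hκ_def
  set red : O →+* κ := IsLocalRing.residue O with hred_def
  set F : κ[X] := ((NR.map red).map fun a => X - C a).prod with hF_def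
  set G : κ[X] := ((NS.map red).map fun a => X - C a).prod with hG_def
  have hFmap : PR.map red = F := map_multiset_prod_X_sub_C NR red
  have hGmap : PS.map red = G := map_multiset_prod_X_sub_C NS red
  have hFG : F - G = C (red δO) := by
    rw [← hFmap, ← hGmap, ← Polynomial.map_sub, hPRS, map_C]
  have hF' : F.derivative = C (n : κ) * ((ND.map red).map fun a => X - C a).prod := by
    rw [← hFmap, derivative_map, hPRD, Polynomial.map_mul, map_C, map_natCast,
      map_multiset_prod_X_sub_C]
  have hunit : ∀ m : ℕ, 0 < m → m ≤ n → (m : κ) ≠ 0 := by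
    intro m hm hmn
    rw [← map_natCast red m, hred_def, IsLocalRing.residue_ne_zero_iff_isUnit,
      isUnit_valuationSubring_iff]
    have e : ((m : O) : K) = (m : K) := by simp
    rw [e]
    exact hsmall m hm hmn
  have hnκ : (n : κ) ≠ 0 := hunit n hn le_rfl
  have hcardNR : Multiset.card NR = n := by
    rw [← Multiset.card_map Subtype.val, hNR, ← hsR.natDegree_eq_card_roots, hRn]
  have hFn : F.natDegree = n := by
    rw [hF_def, natDegree_multiset_prod_X_sub_C_eq_card, Multiset.card_map, hcardNR]
  have hsF : F.Splits := splits_multiset_prod_X_sub_C _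
  have hsG : G.Splits := splits_multiset_prod_X_sub_C _
  have hsF' : F.derivative.Splits := by
    rw [hF']; exact (splits_multiset_prod_X_sub_C _).C_mul _
  have hF0 : F ≠ 0 := (monic_multisetProd_X_sub_C _).ne_zero
  have hG0 : G ≠ 0 := (monic_multisetProd_X_sub_C _).ne_zero
  have hFroots : F.roots = NR.map red := roots_multiset_prod_X_sub_C _
  have hGroots : G.roots = NS.map red := roots_multiset_prod_X_sub_C _
  have hrootF : ∀ d ∈ NR, F.IsRoot (red d) := fun d hd =>
    (mem_roots hF0).mp (by rw [hFroots]; exact Multiset.mem_map_of_mem _ hd)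
  have hrootG : ∀ d ∈ NS, G.IsRoot (red d) := fun d hd =>
    (mem_roots hG0).mp (by rw [hGroots]; exact Multiset.mem_map_of_mem _ hd)
  have hcritF : ∀ t, F.derivative.IsRoot t → F.IsRoot t ∨ G.IsRoot t := by
    intro t ht
    rw [IsRoot.def, hF', eval_mul, eval_C, mul_eq_zero, or_iff_right hnκ, ← IsRoot.def] at ht
    have ht' := (mem_roots (monic_multisetProd_X_sub_C _).ne_zero).mpr ht
    rw [roots_multiset_prod_X_sub_C] at ht'
    obtain ⟨d, hd, rfl⟩ := Multiset.mem_map.mp ht'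
    rcases hmemD d hd with h | h
    · exact Or.inl (hrootF d h)
    · exact Or.inr (hrootG d h)
  /- Step 6: the key claim — every non-zero root of `R (R - δ)` is a `v`-unit. -/
  have key : ∀ d : O, (d ∈ NR ∨ d ∈ NS) → (d : K) ≠ 0 → v (d : K) = 1 := by
    intro d hd hd0
    rw [← isUnit_valuationSubring_iff, ← IsLocalRing.residue_ne_zero_iff_isUnit, ← hred_def]
    have hd_ne : d ≠ 0 := fun h => hd0 (by rw [h]; rfl)
    by_cases hδκ : red δO = 0
    · -- degenerate case `δ̄ = 0`: `F = G` has a single root (Cor. 6), yet `0̄ ≠ 1̄` are roots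
      exfalso
      have hFG' : F = G := by rwa [hδκ, C_0, sub_eq_zero] at hFG
      have hcritF' : ∀ t, F.derivative.IsRoot t → F.IsRoot t := fun t ht => by
        rcases hcritF t ht with h | h
        · exact h
        · rwa [hFG']
      have hone := card_roots_eq_one (by rw [hFn]; exact hn) hsF hsF'
        (by rw [hFn]; exact hunit) hcritF'
      have hrt : ∀ d : O, (d ∈ NR ∨ d ∈ NS) → red d ∈ F.roots.toFinset := by
        intro d hd
        rw [Multiset.mem_toFinset]
        rcases hd with h | h
        · exact (mem_roots hF0).mpr (hrootF d h)
        · rw [hFG']; exact (mem_roots hG0).mpr (hrootG d h)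
      have h2 : ({red 0, red 1} : Finset κ) ⊆ F.roots.toFinset := by
        intro x hx
        rw [Finset.mem_insert, Finset.mem_singleton] at hx
        rcases hx with rfl | rfl
        · exact hrt 0 h0mem
        · exact hrt 1 h1mem
      have h3 := Finset.card_le_card h2
      rw [map_zero, map_one, Finset.card_pair zero_ne_one, hone] at h3
      omega
    · -- non-degenerate case (Thm. 1 + Thm. 2): count in `κ` and compare with the count in `K`
      have hcount := card_roots_add_card_roots_eq hδκ hFG (by rw [hFn]; exact hn) hsF hsG hsF'
        (by rw [hFn]; exact hunit) hcritF
      rw [hFn, hFroots, hGroots, Multiset.toFinset_map, Multiset.toFinset_map] at hcount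
      rw [← hNR, ← hNS, Multiset.toFinset_map, Multiset.toFinset_map,
        Finset.card_image_of_injective _ hvalinj, Finset.card_image_of_injective _ hvalinj]
        at hcountK
      have hleR : (NR.toFinset.image red).card ≤ NR.toFinset.card := Finset.card_image_le
      have hleS : (NS.toFinset.image red).card ≤ NS.toFinset.card := Finset.card_image_le
      have hinjR : Set.InjOn red NR.toFinset := Finset.card_image_iff.mp (by omega)
      have hinjS : Set.InjOn red NS.toFinset := Finset.card_image_iff.mp (by omega)
      have hdisj : ∀ t, F.IsRoot t → G.IsRoot t → False := by
        intro t htF htG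
        apply hδκ
        have e := congrArg (eval t) hFG
        rw [eval_sub, htF.eq_zero, htG.eq_zero, sub_zero, eval_C] at e
        exact e.symm
      intro hd_red
      have hred0 : red d = red 0 := by rw [hd_red, map_zero]
      rcases hd with hd | hd <;> rcases h0mem with h0' | h0'
      · exact hd_ne (hinjR (by simpa using hd) (by simpa using h0') hred0)
      · exact hdisj _ (hrootF d hd) (by rw [hred0]; exact hrootG 0 h0')
      · exact hdisj _ (by rw [hred0]; exact hrootF 0 h0') (hrootG d hd)
      · exact hd_ne (hinjS (by simpa using hd) (by simpa using h0') hred0)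
  /- Step 7 (Thm. 3): all non-zero roots have valuation `v γ`, and `1` is one of them. -/
  have hroots : ∀ w : K, w ≠ 0 → (B.eval w = 0 ∨ B.eval w = 1) → v w = v γ := by
    intro w hw hBw
    have hw' : B.eval (γ * (γ⁻¹ * w)) = 0 ∨ B.eval (γ * (γ⁻¹ * w)) = 1 := by
      rwa [mul_inv_cancel_left₀ hγ0]
    have hmemO : γ⁻¹ * w ∈ O := (v.mem_valuationSubring_iff _).mpr (hval _ hw')
    have hd : (⟨γ⁻¹ * w, hmemO⟩ : O) ∈ NR ∨ (⟨γ⁻¹ * w, hmemO⟩ : O) ∈ NS := by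
      rcases hw' with h | h
      · exact Or.inl ((hmemR _).mpr h)
      · exact Or.inr ((hmemS _).mpr h)
    have hk := key _ hd (mul_ne_zero (inv_ne_zero hγ0) hw)
    have hvγ : v γ ≠ 0 := (Valuation.ne_zero_iff v).mpr hγ0
    change v (γ⁻¹ * w) = 1 at hk
    rwa [map_mul, map_inv₀, inv_mul_eq_one₀ hvγ, eq_comm] at hk
  have hvγ1 : v γ = 1 := by rw [← hroots 1 one_ne_zero h1, map_one]
  rw [hroots z hz hBz, hvγ1]

end Core

section NumberField

/-- A number field has, above every rational prime `p`, a valuation `v` with `v(p) < 1` and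
`v(m) ≤ 1` on the integers (the `𝔭`-adic valuation of a prime `𝔭 ∣ p` of `𝓞 K`). [folklore] -/
theorem exists_valuation_lt_one_of_prime (K : Type*) [Field K] [NumberField K] {p : ℕ}
    (hp : p.Prime) : ∃ v : Valuation K (WithZero (Multiplicative ℤ)),
      v p < 1 ∧ ∀ m : ℤ, v m ≤ 1 := by
  have hirr : Irreducible (p : ℤ) := (Nat.prime_iff_prime_int.mp hp).irreducible
  haveI hmax : (Ideal.span {(p : ℤ)}).IsMaximal := PrincipalIdealRing.isMaximal_of_irreducible hirr
  obtain ⟨Q, hQmax, hQover⟩ :=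
    Ideal.exists_maximal_ideal_liesOver_of_isIntegral (S := NumberField.RingOfIntegers K)
      (Ideal.span {(p : ℤ)})
  have hpQ : ((p : ℤ) : NumberField.RingOfIntegers K) ∈ Q := by
    have h : (p : ℤ) ∈ Q.comap (algebraMap ℤ (NumberField.RingOfIntegers K)) := by
      rw [← Ideal.under_def, ← hQover.over]
      exact Ideal.mem_span_singleton_self _
    simpa using h
  have hQne : Q ≠ ⊥ := by
    intro h
    rw [h, Ideal.mem_bot] at hpQ
    exact (Int.cast_ne_zero.mpr (by exact_mod_cast hp.ne_zero)) hpQ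
  let w : IsDedekindDomain.HeightOneSpectrum (NumberField.RingOfIntegers K) :=
    ⟨Q, hQmax.isPrime, hQne⟩
  refine ⟨w.valuation K, ?_, fun m => ?_⟩
  · have h := (w.valuation_lt_one_iff_mem (K := K) ((p : ℤ) : NumberField.RingOfIntegers K)).mpr
      hpQ
    simpa using h
  · have h := w.valuation_le_one (K := K) (m : NumberField.RingOfIntegers K)
    simpa using h

variable {K : Type*} [Field K] {Γ₀ : Type*} [LinearOrderedCommGroupWithZero Γ₀]

/-- For a valuation with `v(p) < 1` and `v ≤ 1` on `ℤ`, integers prime to `p` are units.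
[folklore] -/
theorem valuation_intCast_eq_one_of_isCoprime {v : Valuation K Γ₀} {p : ℕ} (hvp : v p < 1)
    (hvZ : ∀ m : ℤ, v m ≤ 1) {m : ℤ} (hm : IsCoprime m p) : v m = 1 := by
  obtain ⟨a, b, hab⟩ := hm
  refine le_antisymm (hvZ m) (not_lt.mp fun hlt => ?_)
  have h1 : v ((a * m + b * p : ℤ) : K) = 1 := by rw [hab]; simp
  have h2 : v ((a * m + b * p : ℤ) : K) < 1 := by
    push_cast
    refine (v.map_add _ _).trans_lt (max_lt ?_ ?_)
    · rw [map_mul]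
      calc v a * v m ≤ 1 * v m := mul_le_mul' (hvZ a) le_rfl
        _ < 1 := by rwa [one_mul]
    · rw [map_mul]
      calc v b * v p ≤ 1 * v p := mul_le_mul' (hvZ b) le_rfl
        _ < 1 := by rwa [one_mul]
  exact h2.ne h1

/-- For a valuation with `v(p) < 1` and `v ≤ 1` on `ℤ`, multiples of `p` have valuation `< 1`.
[folklore] -/
theorem valuation_intCast_lt_one_of_dvd {v : Valuation K Γ₀} {p : ℕ} (hvp : v p < 1)
    (hvZ : ∀ m : ℤ, v m ≤ 1) {m : ℤ} (hm : (p : ℤ) ∣ m) : v m < 1 := by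
  obtain ⟨k, rfl⟩ := hm
  push_cast
  rw [map_mul]
  calc v p * v k ≤ v p * 1 := mul_le_mul' le_rfl (hvZ k)
    _ < 1 := by rwa [mul_one]

end NumberField

section Complex

/-- A complex root of a non-zero polynomial with algebraic coefficients is algebraic (roots of the
lift to `ℚ̄ = algebraicClosure ℚ ℂ`, which is algebraically closed). [folklore] -/
theorem isAlgebraic_of_mem_roots_of_isAlgebraic_coeff {B : ℂ[X]}
    (halg : ∀ n, IsAlgebraic ℚ (B.coeff n)) {z : ℂ} (hz : z ∈ B.roots) : IsAlgebraic ℚ z := by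
  haveI : IsAlgClosed (algebraicClosure ℚ ℂ) := (algebraicClosure.isAlgClosure ℚ ℂ).isAlgClosed
  have hlift : B ∈ Polynomial.lifts (algebraMap (algebraicClosure ℚ ℂ) ℂ) := by
    rw [lifts_iff_coeff_lifts]
    intro k
    exact ⟨⟨B.coeff k, mem_algebraicClosure_iff.mpr (halg k)⟩, rfl⟩
  obtain ⟨BL, hBL⟩ := (mem_lifts _).1 hlift
  have hroots :=
    (IsAlgClosed.splits BL).roots_map_of_injective (algebraMap (algebraicClosure ℚ ℂ) ℂ).injective
  rw [hBL] at hroots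
  rw [hroots] at hz
  obtain ⟨w, _, rfl⟩ := Multiset.mem_map.mp hz
  exact mem_algebraicClosure_iff.mp w.2

/-- **Rodriguez (2013), Theorem 3 for rational numbers** — discharge of the named fact
`Rodriguez2013_prime_le_natDegree`: a Belyi polynomial `B` taking the value `0` or `1` at a
rational `a/b ≠ 0` in lowest terms has degree `≥` every prime `p ∣ ab`.  Proof: if `deg B < p`,
pass to the number field `K = ℚ(coefficients, roots of B, roots of B - 1) ⊂ ℂ` and a prime of
`𝓞 K` above `p`; by `valuation_eq_one_of_critical_values` every non-zero `z` with
`B(z) ∈ {0,1}` is a unit there, but `v_𝔭(a/b) ≠ 0`.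
[cite: Rodriguez2013, Thm. 3 and the remark following it] -/
theorem Rodriguez2013_prime_le_natDegree_holds : Rodriguez2013_prime_le_natDegree := by
  intro B hBel a b ha hb hcop hroot p hp
  obtain ⟨halg, hdeg, h0, h1, hcrit⟩ := hBel
  refine le_of_not_gt fun hlt => ?_
  have hpprime : p.Prime := Nat.prime_of_mem_primeFactors hp
  have hpdvd : p ∣ a.natAbs * b := Nat.dvd_of_mem_primeFactors hp
  classical
  have hB : B ≠ 0 := ne_zero_of_natDegree_gt hdeg
  have hB1 : B - 1 ≠ 0 := by
    intro h
    have h' : (B - C 1).natDegree = B.natDegree := natDegree_sub_C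
    rw [C_1, h, natDegree_zero] at h'
    omega
  have hB' : B.derivative ≠ 0 := by
    rw [Ne, derivative_eq_zero]; exact hdeg.ne'
  -- the finite set of algebraic numbers we need, and the number field they generate
  set S : Finset ℂ := B.coeffs ∪ B.roots.toFinset ∪ (B - 1).roots.toFinset with hS_def
  have halg1 : ∀ n, IsAlgebraic ℚ ((B - 1).coeff n) := by
    intro n
    rw [coeff_sub, coeff_one]
    split_ifs
    · exact (halg n).sub isAlgebraic_one
    · rw [sub_zero]; exact halg n
  have hSint : ∀ x ∈ (S : Set ℂ), IsIntegral ℚ x := by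
    intro x hx
    rw [Finset.mem_coe, hS_def, Finset.mem_union, Finset.mem_union, Multiset.mem_toFinset,
      Multiset.mem_toFinset] at hx
    refine IsAlgebraic.isIntegral ?_
    rcases hx with (hx | hx) | hx
    · obtain ⟨n, -, rfl⟩ := mem_coeffs_iff.mp hx
      exact halg n
    · exact isAlgebraic_of_mem_roots_of_isAlgebraic_coeff halg hx
    · exact isAlgebraic_of_mem_roots_of_isAlgebraic_coeff halg1 hx
  set Kf := IntermediateField.adjoin ℚ (S : Set ℂ) with hKf_def
  haveI : FiniteDimensional ℚ Kf := IntermediateField.finiteDimensional_adjoin hSint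
  haveI : NumberField Kf := NumberField.of_module_finite ℚ Kf
  have hSK : ∀ x ∈ S, x ∈ Kf := fun x hx => IntermediateField.subset_adjoin ℚ _ hx
  set φ := algebraMap Kf ℂ with hφ_def
  have hinj : Function.Injective φ := φ.injective
  -- descend `B` to `K`
  have hlift : B ∈ lifts φ := by
    rw [lifts_iff_coeff_lifts]
    intro k
    by_cases hk : B.coeff k = 0
    · exact ⟨0, by rw [map_zero, hk]⟩
    · exact ⟨⟨B.coeff k, hSK _ (by simp [hS_def, coeff_mem_coeffs hk])⟩, rfl⟩
  obtain ⟨BK, hBK⟩ := (mem_lifts _).1 hlift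
  have hBK1 : (BK - 1).map φ = B - 1 := by rw [Polynomial.map_sub, Polynomial.map_one, hBK]
  have hBK' : BK.derivative.map φ = B.derivative := by rw [← derivative_map, hBK]
  have hdegK : BK.natDegree = B.natDegree := by rw [← hBK, natDegree_map_eq_of_injective hinj]
  have hevalK : ∀ x : Kf, φ (BK.eval x) = B.eval (φ x) := fun x => by
    rw [← hBK, eval_map, eval₂_hom]
  have heval'K : ∀ x : Kf, φ (BK.derivative.eval x) = B.derivative.eval (φ x) := fun x => by
    rw [← hBK', eval_map, eval₂_hom]
  have htrans : ∀ x : Kf,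
      (BK.eval x = 0 ∨ BK.eval x = 1) ↔ (B.eval (φ x) = 0 ∨ B.eval (φ x) = 1) := by
    intro x
    rw [← hevalK]
    constructor
    · rintro (h | h)
      · left; rw [h, map_zero]
      · right; rw [h, map_one]
    · rintro (h | h)
      · left; exact hinj (by rw [h, map_zero])
      · right; exact hinj (by rw [h, map_one])
  have h0K : BK.eval 0 = 0 ∨ BK.eval 0 = 1 := by rw [htrans, map_zero]; exact h0
  have h1K : BK.eval 1 = 0 ∨ BK.eval 1 = 1 := by rw [htrans, map_one]; exact h1
  have hcritK : ∀ x : Kf, BK.derivative.eval x = 0 → BK.eval x = 0 ∨ BK.eval x = 1 := by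
    intro x hx
    rw [htrans]
    apply hcrit
    rw [← heval'K, hx, map_zero]
  -- every complex root of `B`, `B - 1`, `B'` lies in `K`, so the descended polynomials split
  have hrange : ∀ z : ℂ, (B.eval z = 0 ∨ B.eval z = 1) → z ∈ φ.range := by
    intro z hz
    have hzS : z ∈ S := by
      rw [hS_def, Finset.mem_union, Finset.mem_union, Multiset.mem_toFinset,
        Multiset.mem_toFinset, mem_roots hB, mem_roots hB1, IsRoot.def, IsRoot.def, eval_sub,
        eval_one, sub_eq_zero]
      tauto
    exact ⟨⟨z, hSK z hzS⟩, rfl⟩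
  have hsBK : BK.Splits := by
    refine Splits.of_splits_map φ (by rw [hBK]; exact IsAlgClosed.splits B) ?_
    intro z hz
    rw [hBK, mem_roots hB] at hz
    exact hrange z (Or.inl hz)
  have hsBK1 : (BK - 1).Splits := by
    refine Splits.of_splits_map φ (by rw [hBK1]; exact IsAlgClosed.splits _) ?_
    intro z hz
    rw [hBK1, mem_roots hB1, IsRoot.def, eval_sub, eval_one, sub_eq_zero] at hz
    exact hrange z (Or.inr hz)
  have hsBK' : BK.derivative.Splits := by
    refine Splits.of_splits_map φ (by rw [hBK']; exact IsAlgClosed.splits _) ?_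
    intro z hz
    rw [hBK', mem_roots hB'] at hz
    exact hrange z (hcrit z hz)
  -- the valuation above `p`
  obtain ⟨v, hvp, hvZ⟩ := exists_valuation_lt_one_of_prime Kf hpprime
  have hsmall : ∀ m : ℕ, 0 < m → m ≤ BK.natDegree → v m = 1 := by
    intro m hm hmn
    have hmp : Nat.Coprime m p :=
      ((Nat.Prime.coprime_iff_not_dvd hpprime).mpr (Nat.not_dvd_of_pos_of_lt hm (by omega))).symm
    have h := valuation_intCast_eq_one_of_isCoprime hvp hvZ (Nat.isCoprime_iff_coprime.mpr hmp)
    simpa using h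
  -- the rational root, seen in `K`
  set lam : Kf := (a : Kf) / (b : Kf) with hlam_def
  have hlam0 : lam ≠ 0 :=
    div_ne_zero (Int.cast_ne_zero.mpr ha) (Nat.cast_ne_zero.mpr hb.ne')
  have hφlam : φ lam = (a : ℂ) / (b : ℂ) := by
    rw [hlam_def, map_div₀, map_intCast, map_natCast]
  have hBlam : BK.eval lam = 0 ∨ BK.eval lam = 1 := by rw [htrans, hφlam]; exact hroot
  have hvlam := valuation_eq_one_of_critical_values v (hdegK ▸ hdeg) hsmall h0K h1K hcritK hsBK
    hsBK1 hsBK' hlam0 hBlam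
  -- but `v(a/b) ≠ 1` since `p ∣ ab`
  rw [hlam_def, map_div₀] at hvlam
  rcases (Nat.Prime.dvd_mul hpprime).mp hpdvd with hpa | hpb
  · have hbp : Nat.Coprime b p := (Nat.Coprime.coprime_dvd_left hpa hcop).symm
    have hvb : v (b : Kf) = 1 := by
      have h := valuation_intCast_eq_one_of_isCoprime hvp hvZ (Nat.isCoprime_iff_coprime.mpr hbp)
      simpa using h
    have hva : v (a : Kf) < 1 :=
      valuation_intCast_lt_one_of_dvd hvp hvZ (Int.natCast_dvd.mpr hpa)
    rw [hvb, div_one] at hvlam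
    exact hva.ne hvlam
  · have hap : IsCoprime (a : ℤ) (p : ℤ) := by
      rw [Int.isCoprime_iff_gcd_eq_one]
      exact Nat.Coprime.coprime_dvd_right hpb hcop
    have hva : v (a : Kf) = 1 := valuation_intCast_eq_one_of_isCoprime hvp hvZ hap
    have hvb : v (b : Kf) < 1 := by
      have h := valuation_intCast_lt_one_of_dvd hvp hvZ
        (Int.natCast_dvd_natCast.mpr hpb : ((p : ℤ) ∣ (b : ℤ)))
      simpa using h
    rw [hva, one_div] at hvlam
    exact hvb.ne (inv_eq_one.mp hvlam)

end Complex

end Literature.NumberTheory.DiophantineGeometry
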